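import Mathlib
import HarnessLib
import Literature.Analysis.FluidPDE.ClassicalSolution
import Literature.Analysis.FluidPDE.LerayHopf
import Summits.NavierStokesRegularity.NavierStokesRegularity.Theses.QuarterJolt
import Summits.NavierStokesRegularity.NavierStokesRegularity.Theorems.QuarterJoltTerminalPairingIncrement
import Summits.NavierStokesRegularity.NavierStokesRegularity.Theorems.QuarterJoltTerminalPairingLaw
import Summits.NavierStokesRegularity.NavierStokesRegularity.Theorems.QuarterJoltEnergyJumpDefect
import Summits.NavierStokesRegularity.NavierStokesRegularity.Theorems.CertifiedBlowupCertifiedBlowupAxisymBlowupEnergyDrain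

/-!
# Route QuarterJolt — crux `NoTerminalJolt` (stmt-NavierStokesRegularity-26463), LEAD line
# `regular_split` rev 4: A FIRST BLOW-UP WITH A REGULAR TERMINAL VALUE JOLTS

Seat ns-ntj-p1 g3 (LEAD of the crux; `--supports 26463 --as helper`), sequel of
`QuarterJoltTerminalPairingLaw.lean` (p633723: at a first blow-up time the energy drop is
self-similar-sized, `∫‖u(t)‖² − ∫‖u(T)‖² ≥ 4cν^{5/2}√(T−t)`, and
`∫‖u(t) − u(T)‖² = drop(t) − 2·pair(t)`) and `QuarterJoltTerminalPairingIncrement.lean`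
(`pair_isLittleO`: against a REGULAR terminal value — smooth, bounded, divergence free,
`Du(T) ∈ L²` — the pairing excess `pair(t) = ∫⟪u(t) − u(T), u(T)⟫` is `o(√(T−t))`).

* `pair_isLittleO` — from `pair_abs_le` (`QuarterJoltTerminalPairingIncrement`): optimising
  `η ∼ √(T−t)/δ` and using that the dissipation tail `∫ₜᵀ∫|Du|²_F → 0` (finite total dissipation,
  continuity from below `tendsto_setLIntegral_Ioo_nhdsLT`): for every `δ > 0`, eventually
  `|∫⟪u(t) − u(T), u(T)⟫| ≤ δ√(T−t)`.
* `liminf_joltFunctional_ge_of_regularTerminalValue` — with Leray's universal `c > 0`: a MAXIMAL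
  classical solution on `[0,T)` (`ν, T > 0`), Leray–Hopf on `[0,T]` from a rapidly decaying datum, whose
  terminal value `u(T)` is regular, has `(√(T−t))⁻¹ ∫‖u(t) − u(T)‖² ≥ 4cν^{5/2} − δ` eventually, for
  every `δ > 0`: it approaches its terminal value EXACTLY at the self-similar `L²` rate from above.
* **`jolt_of_regularTerminalValue`** — hence such a blow-up JOLTS (the jolt functional does not tend
  to `0`); generalises `jolt_of_terminalValue_eq_zero` (extinct terminal value).
* `not_regularTerminalValue_of_noTerminalJolt` — the crux BY NAME implies: at every first blow-up time
  of every frame solution, the Leray–Hopf terminal value `u(T)` is NOT a smooth bounded divergence-free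
  field with `Du(T) ∈ L²` — «no terminal jolt ⇒ blow-ups leave ROUGH terminal profiles». Complement of
  the energy-jump law (`QuarterJoltEnergyJumpLaw`): under the crux the ENERGY of `u(t)` is continuous at
  `T`, but the terminal slice cannot be regular.

HONEST FRAMING: statements about HYPOTHETICAL first blow-ups; nothing here proves `NoTerminalJolt`,
excludes blow-up, or proves Navier–Stokes regularity. No summit statement is proved here. [folklore]
-/

noncomputable section

-- the summit and its single sub-problem share the name (CONVENTIONS §1), as in every Theorems file
set_option linter.dupNamespace false

namespace Summit.NavierStokesRegularity.NavierStokesRegularity.Theorems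

open MeasureTheory Set Function Filter Topology InnerProductSpace
open scoped ENNReal NNReal ContDiff RealInnerProductSpace
open Literature.Analysis.FluidPDE

namespace NoTerminalJolt

/-! ### The pairing rate `o(√(T−t))` -/

/-- **The pairing rate `∫⟪u(t) − u(T), u(T)⟫ = o(√(T−t))` against a regular terminal value** (frame as
in `pair_abs_le`): for every `δ > 0`, eventually as `t ↑ T`, `|∫⟪u(t) − u(T), u(T)⟫| ≤ δ √(T−t)` —
optimise `η ∼ √(T−t)/δ` in `pair_abs_le` and use that the dissipation tail `∫⁻_{(t,T)}∫⁻|Du|²_F`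
tends to `0` (finite total dissipation, continuity from below). [folklore] -/
theorem pair_isLittleO {ν T : ℝ} (hν : 0 < ν) (hT : 0 < T)
    {u : ℝ → EuclideanSpace ℝ (Fin 3) → EuclideanSpace ℝ (Fin 3)} {p : ℝ → EuclideanSpace ℝ (Fin 3) → ℝ}
    (hcl : IsClassicalNSSolutionOn (Ico 0 T) ν 0 u p) (hLH : IsLerayHopfOn T ν 0 (u 0) u)
    (hdec : HasRapidSpatialDecay (u 0))
    (hUs : ContDiff ℝ ∞ (u T)) (hdivU : VectorCalculus.IsDivFree (u T)) {L : ℝ}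
    (hL : ∀ x, ‖u T x‖ ≤ L) (l2DU : ∫⁻ x, ‖fderiv ℝ (u T) x‖ₑ ^ 2 < ⊤)
    {δ : ℝ} (hδ : 0 < δ) :
    ∀ᶠ t in 𝓝[<] T, |∫ x, ⟪u t x - u T x, u T x⟫| ≤ δ * Real.sqrt (T - t) := by
  -- constants
  set c₁ : ℝ := ν * (∫ x, frobeniusNormSq (fderiv ℝ (u T) x)) +
    L ^ 2 * (2 * VectorCalculus.kineticEnergy (u 0)) with hc₁
  have hc₁0 : 0 ≤ c₁ := by
    have : 0 ≤ ∫ x, frobeniusNormSq (fderiv ℝ (u T) x) :=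
      integral_nonneg fun x => frobeniusNormSq_nonneg _
    have := kineticEnergy_nonneg (u 0)
    rw [hc₁]; positivity
  -- the dissipation tail tends to `0`
  set F : ℝ → ℝ≥0∞ := fun τ => ∫⁻ x, ENNReal.ofReal (frobeniusNormSq (fderiv ℝ (u τ) x)) with hF
  set μF : Measure ℝ := volume.withDensity F with hμF
  have htot : μF (Ioo 0 T) ≠ ⊤ := by
    rw [hμF, withDensity_apply F measurableSet_Ioo]
    exact (CertifiedBlowupAxisymBlowup.EnergyDrain.dissipation_le_energy_sub hν hcl hLH le_rfl
      hT.le le_rfl).1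
  have htail_eq : ∀ t ∈ Ioo 0 T, (∫⁻ τ in Ioo t T, F τ) = μF (Ioo 0 T) - μF (Ioo 0 t) := by
    intro t ht
    have h1 : (∫⁻ τ in Ioo t T, F τ) = μF (Ioo t T) := (withDensity_apply F measurableSet_Ioo).symm
    have hac : μF ≪ volume := withDensity_absolutelyContinuous _ _
    have h2 : μF (Ioo 0 t) = μF (Ioc 0 t) :=
      measure_congr (hac.ae_eq (Ioo_ae_eq_Ioc (μ := volume) (a := (0 : ℝ)) (b := t)))
    have hunion : Ioc 0 t ∪ Ioo t T = Ioo 0 T := Ioc_union_Ioo_eq_Ioo ht.1.le ht.2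
    have hdisj : Disjoint (Ioc 0 t) (Ioo t T) :=
      (Ioc_disjoint_Ioi le_rfl).mono_right Ioo_subset_Ioi_self
    have hadd : μF (Ioc 0 t) + μF (Ioo t T) = μF (Ioo 0 T) := by
      rw [← measure_union hdisj measurableSet_Ioo, hunion]
    have hfin : μF (Ioc 0 t) ≠ ⊤ :=
      ((measure_mono fun τ hτ => (⟨hτ.1, hτ.2.trans_lt ht.2⟩ : τ ∈ Ioo 0 T)).trans_lt htot.lt_top).ne
    rw [h1, h2]
    exact ENNReal.eq_sub_of_add_eq hfin (by rw [add_comm]; exact hadd)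
  have htail : Tendsto (fun t => ∫⁻ τ in Ioo t T, F τ) (𝓝[<] T) (𝓝 0) := by
    have h1 : Tendsto (fun t => μF (Ioo 0 t)) (𝓝[<] T) (𝓝 (μF (Ioo 0 T))) := by
      have h := tendsto_setLIntegral_Ioo_nhdsLT F hT
      have heq : ∀ t, (∫⁻ τ in Ioo 0 t, F τ) = μF (Ioo 0 t) := fun t =>
        (withDensity_apply F measurableSet_Ioo).symm
      simp_rw [heq] at h
      exact h
    have h2 := ENNReal.Tendsto.sub (tendsto_const_nhds (x := μF (Ioo 0 T))) h1 (Or.inl htot)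
    rw [tsub_self] at h2
    refine h2.congr' ?_
    filter_upwards [Ioo_mem_nhdsLT hT] with t ht
    exact (htail_eq t ht).symm
  -- eventually the tail is `≤ δ²/((ν+1)(c₁+1))`
  have hthr : 0 < δ ^ 2 / ((ν + 1) * (c₁ + 1)) := by positivity
  have hev : ∀ᶠ t in 𝓝[<] T, (∫⁻ τ in Ioo t T, F τ) < ENNReal.ofReal (δ ^ 2 / ((ν + 1) * (c₁ + 1))) :=
    htail.eventually (gt_mem_nhds (ENNReal.ofReal_pos.2 hthr))
  filter_upwards [hev, Ioo_mem_nhdsLT hT] with t hDt ht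
  have hTt : 0 < T - t := sub_pos.2 ht.2
  have hsq : 0 < Real.sqrt (T - t) := Real.sqrt_pos.2 hTt
  -- the choice `η = (c₁ + 1) √(T−t) / δ`
  set η : ℝ := (c₁ + 1) * Real.sqrt (T - t) / δ with hη
  have hηpos : 0 < η := by rw [hη]; positivity
  have h := pair_abs_le hν hT hcl hLH hdec hUs hdivU hL l2DU hηpos ht
  have hDfin : (∫⁻ τ in Ioo t T, F τ) ≠ ⊤ := (hDt.trans ENNReal.ofReal_lt_top).ne
  have hDle : (∫⁻ τ in Ioo t T, F τ).toReal ≤ δ ^ 2 / ((ν + 1) * (c₁ + 1)) := by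
    have := (ENNReal.toReal_le_toReal hDfin ENNReal.ofReal_ne_top).2 hDt.le
    rwa [ENNReal.toReal_ofReal hthr.le] at this
  -- first term ≤ (δ/2)√(T−t)
  have h1 : (ν + 1) / 2 * η * (∫⁻ τ in Ioo t T, F τ).toReal ≤ δ / 2 * Real.sqrt (T - t) := by
    calc (ν + 1) / 2 * η * (∫⁻ τ in Ioo t T, F τ).toReal
        ≤ (ν + 1) / 2 * η * (δ ^ 2 / ((ν + 1) * (c₁ + 1))) :=
          mul_le_mul_of_nonneg_left hDle (by positivity)
      _ = δ / 2 * Real.sqrt (T - t) := by rw [hη]; field_simp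
  -- second term ≤ (δ/2)√(T−t)
  have h2 : c₁ / (2 * η) * (T - t) ≤ δ / 2 * Real.sqrt (T - t) := by
    have e1 : c₁ / (2 * η) * (T - t) = (c₁ / (c₁ + 1)) * (δ / 2 * Real.sqrt (T - t)) := by
      rw [hη]
      have hst : Real.sqrt (T - t) * Real.sqrt (T - t) = T - t := Real.mul_self_sqrt hTt.le
      field_simp
      nlinarith [hst]
    rw [e1]
    have hfrac : c₁ / (c₁ + 1) ≤ 1 := by
      rw [div_le_one (by positivity)]; linarith
    have hpos : 0 ≤ δ / 2 * Real.sqrt (T - t) := by positivity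
    nlinarith
  rw [← hc₁] at h
  linarith

/-! ### A first blow-up with a regular terminal value jolts -/

/-- **`liminf D ≥ 4cν^{5/2}` for a regular terminal value.** There is a universal `c > 0` (that of
`energyDrop_ge_sqrt`, Leray's constant) such that for every MAXIMAL classical solution on `[0,T)`
(`ν, T > 0`), Leray–Hopf on `[0,T]` from a rapidly decaying datum, whose terminal value `u(T)` is
regular (smooth, bounded, divergence free, `Du(T) ∈ L²`), and every `δ > 0`: eventually as `t ↑ T`,
`4cν^{5/2} − δ ≤ (√(T−t))⁻¹ ∫‖u(t) − u(T)‖²` — by `∫‖u(t) − u(T)‖² = drop(t) − 2 pair(t)`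
(`integral_norm_sub_sq_eq_drop_sub_pair`), `drop(t) ≥ 4cν^{5/2}√(T−t)` (`energyDrop_ge_sqrt`) and
`pair(t) = o(√(T−t))` (`pair_isLittleO`). [folklore] -/
theorem liminf_joltFunctional_ge_of_regularTerminalValue : ∃ c : ℝ, 0 < c ∧ ∀ {ν T : ℝ}
    {u : ℝ → EuclideanSpace ℝ (Fin 3) → EuclideanSpace ℝ (Fin 3)} {p : ℝ → EuclideanSpace ℝ (Fin 3) → ℝ},
    0 < ν → 0 < T → IsMaximalSmoothSolution ν 0 u p T → IsLerayHopfOn T ν 0 (u 0) u →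
    HasRapidSpatialDecay (u 0) → ContDiff ℝ ∞ (u T) → VectorCalculus.IsDivFree (u T) →
    (∃ L : ℝ, ∀ x, ‖u T x‖ ≤ L) → ∫⁻ x, ‖fderiv ℝ (u T) x‖ₑ ^ 2 < ⊤ →
    ∀ δ : ℝ, 0 < δ → ∀ᶠ t in 𝓝[<] T,
      4 * c * ν ^ (5 / 2 : ℝ) - δ ≤ (Real.sqrt (T - t))⁻¹ * ∫ x, ‖u t x - u T x‖ ^ 2 := by
  obtain ⟨c, hc, hdrop⟩ := energyDrop_ge_sqrt
  refine ⟨c, hc, fun {ν T u p} hν hT hmax hLH hdec hUs hdivU hL l2DU δ hδ => ?_⟩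
  obtain ⟨L, hL⟩ := hL
  have hpair := pair_isLittleO hν hT hmax.1 hLH hdec hUs hdivU hL l2DU (half_pos hδ)
  filter_upwards [hpair, Ioo_mem_nhdsLT hT] with t hpt ht
  have hsq : 0 < Real.sqrt (T - t) := Real.sqrt_pos.2 (sub_pos.2 ht.2)
  have hid := integral_norm_sub_sq_eq_drop_sub_pair hT hLH ⟨ht.1.le, ht.2.le⟩
  have hd := hdrop hν hT hmax hLH hdec t ⟨ht.1.le, ht.2⟩
  have habs := (abs_le.1 hpt).2
  rw [le_inv_mul_iff₀ hsq]
  nlinarith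

/-- **A FIRST BLOW-UP WITH A REGULAR TERMINAL VALUE JOLTS.** A maximal classical solution on `[0,T)`
(`ν, T > 0`), Leray–Hopf on `[0,T]` from a rapidly decaying datum, whose Leray–Hopf terminal value
`u(T)` is a smooth, bounded, divergence-free field with `Du(T) ∈ L²`, has a jolt functional
`(√(T−t))⁻¹ ∫‖u(t) − u(T)‖²` that does NOT tend to `0` as `t ↑ T` (it stays `≥ 4cν^{5/2} − o(1)`).
[folklore] -/
theorem jolt_of_regularTerminalValue {ν T : ℝ} (hν : 0 < ν) (hT : 0 < T)
    {u : ℝ → EuclideanSpace ℝ (Fin 3) → EuclideanSpace ℝ (Fin 3)} {p : ℝ → EuclideanSpace ℝ (Fin 3) → ℝ}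
    (hmax : IsMaximalSmoothSolution ν 0 u p T) (hLH : IsLerayHopfOn T ν 0 (u 0) u)
    (hdec : HasRapidSpatialDecay (u 0))
    (hUs : ContDiff ℝ ∞ (u T)) (hdivU : VectorCalculus.IsDivFree (u T))
    (hL : ∃ L : ℝ, ∀ x, ‖u T x‖ ≤ L) (l2DU : ∫⁻ x, ‖fderiv ℝ (u T) x‖ₑ ^ 2 < ⊤) :
    ¬ Tendsto (fun t : ℝ => (Real.sqrt (T - t))⁻¹ * ∫ x, ‖u t x - u T x‖ ^ 2) (𝓝[<] T) (𝓝 0) := by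
  obtain ⟨c, hc, hlaw⟩ := liminf_joltFunctional_ge_of_regularTerminalValue
  intro hJ
  have hcν : 0 < 4 * c * ν ^ (5 / 2 : ℝ) := by positivity
  have h1 := hlaw hν hT hmax hLH hdec hUs hdivU hL l2DU (2 * c * ν ^ (5 / 2 : ℝ)) (by positivity)
  have h2 : ∀ᶠ t in 𝓝[<] T, (Real.sqrt (T - t))⁻¹ * ∫ x, ‖u t x - u T x‖ ^ 2 < c * ν ^ (5 / 2 : ℝ) :=
    hJ.eventually (Iio_mem_nhds (by positivity))
  obtain ⟨t, ht1, ht2⟩ := (h1.and h2).exists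
  linarith

/-- **`NoTerminalJolt ⇒ first blow-ups leave ROUGH terminal profiles`** (the crux BY NAME): for every
`ν, T > 0` and every MAXIMAL frame solution (first blow-up at `T`), the Leray–Hopf terminal value
`u(T)` is NOT a smooth bounded divergence-free field with `Du(T) ∈ L²`. Conditional on the OPEN crux;
nothing is asserted about it or about the existence of blow-ups. [folklore] -/
theorem not_regularTerminalValue_of_noTerminalJolt (h : Theses.QuarterJolt.NoTerminalJolt) :
    ∀ (ν T : ℝ), 0 < ν → 0 < T →
      ∀ (u : ℝ → EuclideanSpace ℝ (Fin 3) → EuclideanSpace ℝ (Fin 3))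
        (p : ℝ → EuclideanSpace ℝ (Fin 3) → ℝ),
        Literature.Analysis.FluidPDE.IsMaximalSmoothSolution ν 0 u p T →
        Literature.Analysis.FluidPDE.IsLerayHopfOn T ν 0 (u 0) u →
        Literature.Analysis.FluidPDE.HasRapidSpatialDecay (u 0) →
        ¬ (ContDiff ℝ ∞ (u T) ∧ VectorCalculus.IsDivFree (u T) ∧ (∃ L : ℝ, ∀ x, ‖u T x‖ ≤ L) ∧
            ∫⁻ x, ‖fderiv ℝ (u T) x‖ₑ ^ 2 < ⊤) :=
  fun ν T hν hT u p hmax hLH hdec hreg =>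
    jolt_of_regularTerminalValue hν hT hmax hLH hdec hreg.1 hreg.2.1 hreg.2.2.1 hreg.2.2.2
      (h ν T hν hT u p hmax.1 hLH hdec)

end NoTerminalJolt

end Summit.NavierStokesRegularity.NavierStokesRegularity.Theorems

end
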